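import Mathlib
import HarnessLib

/-!
# Route UniversalToricDescent — the NORM OPERATOR of a layer of a `ℤ_p`-tower in characteristic `p` and the span it forces
# (brick 1 of the port stub `stub_residualLinkMult` of line `beta-road` v5 on crux `TwinAlgMuZeroAtThree`, stmt-BirchSwinnertonDyer-24737)

Lead prover bsd-wall-utd-p1 g23 (`--supports stmt-BirchSwinnertonDyer-24737`). Pure algebra over `𝔽_p = ZMod p`, used by the
finite-level two-sided link (K1 at a layer `k` ⟹ the Heegner classes at every layer `n = k + m` span, locally at the prime
above `3`, a subspace of dimension `≥ pⁿ − p^k + 1`):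

* §1 `sum_pow_one_add_X_mul_X_pow`, **`sum_pow_one_add_X_eq_X_pow`** — in `𝔽_p[X]`:
  `∑_{i<p^m} (1+X)^{p^k i} = X^{p^{k+m} − p^k}` (the norm `N_{K_n/K_k} = ∑_{i<p^{m}} γ^{p^k i}` of the cyclic layer
  `Gal(K_n/K_k)`, `n = k+m`, written in `𝔽_p[Gal(K_n/K)] = 𝔽_p[T]/(T^{pⁿ})`, `γ = 1+T`; Washington §13.2 / folklore).
* §2 **`sum_pow_eq_sub_one_pow`** — the same identity for ANY element `φ` of ANY `𝔽_p`-algebra: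
  `∑_{i<p^m} φ^{p^k i} = (φ − 1)^{p^{k+m} − p^k}` (evaluation of §1); `sub_one_pow_prime_pow_eq_zero` — `φ^{p^N} = 1 ⟹
  (φ − 1)^{p^N} = 0`.
* §3 **`linearIndependent_pow_apply`** — over a field, `ψ^j u ≠ 0` and `ψ^{j+1} u = 0` ⟹ `u, ψu, …, ψ^j u` are linearly
  independent; `exists_pow_apply_ne_zero_and_succ_eq_zero` — a last non-zero iterate exists below a killing power.
* §4 **`succ_le_finrank_of_sum_pow_apply_ne_zero`** — `V` an `𝔽_p`-module, `φ ∈ End(V)` with `φ^{p^N} = 1`, `u ∈ V` with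
  `(∑_{i<p^m} φ^{p^k i}) u ≠ 0`: every finite-dimensional subspace `W` containing the orbit `{φ^i u}` has
  `dim W ≥ p^{k+m} − p^k + 1`.

THEOREMS ONLY (no definition, no named fact, no `sorry`); Mathlib only. BSD is not advanced by this file.
References: [Washington1997] §13.2 (the identity `ω_n/ω_k ≡ T^{pⁿ−p^k} (mod p)`); folklore linear algebra.
-/

open Polynomial Finset

set_option linter.dupNamespace false
set_option autoImplicit false

namespace Summit.BirchSwinnertonDyer.BirchSwinnertonDyer.Theorems.UniversalToricDescentResidualNormSpan

/-! ## §1 The norm of a cyclic `p`-power layer in `𝔽_p[X]` -/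

section Poly

variable (p : ℕ) [hp : Fact p.Prime]

/-- `(1 + X)^{p^k} = 1 + X^{p^k}` in `𝔽_p[X]`. [folklore] -/
theorem one_add_X_pow_prime_pow (k : ℕ) :
    ((1 : (ZMod p)[X]) + X) ^ p ^ k = 1 + X ^ p ^ k := by
  rw [add_pow_char_pow, one_pow]

/-- `(∑_{i<p^m} (1+X)^{p^k i}) · X^{p^k} = X^{p^{k+m}}` in `𝔽_p[X]` (geometric sum against `(1+X)^{p^k} − 1 = X^{p^k}`).
[cite: Washington1997, §13.2] -/
theorem sum_pow_one_add_X_mul_X_pow (k m : ℕ) :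
    (∑ i ∈ range (p ^ m), ((1 : (ZMod p)[X]) + X) ^ (p ^ k * i)) * X ^ p ^ k = X ^ p ^ (k + m) := by
  have hY : ((1 : (ZMod p)[X]) + X) ^ p ^ k - 1 = X ^ p ^ k := by
    rw [one_add_X_pow_prime_pow, add_sub_cancel_left]
  have hYm : (((1 : (ZMod p)[X]) + X) ^ p ^ k) ^ p ^ m - 1 = X ^ p ^ (k + m) := by
    rw [← pow_mul, ← pow_add, one_add_X_pow_prime_pow, add_sub_cancel_left]
  have hgeom := geom_sum_mul (((1 : (ZMod p)[X]) + X) ^ p ^ k) (p ^ m)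
  rw [hY, hYm] at hgeom
  simp_rw [← pow_mul] at hgeom
  exact hgeom

/-- **`∑_{i<p^m} (1+X)^{p^k i} = X^{p^{k+m} − p^k}` in `𝔽_p[X]`** — the norm operator of the layer `K_{k+m}/K_k` of a
`ℤ_p`-tower in `𝔽_p[Gal(K_{k+m}/K)] = 𝔽_p[T]/(T^{p^{k+m}})`, `γ = 1 + T`. [cite: Washington1997, §13.2] -/
theorem sum_pow_one_add_X_eq_X_pow (k m : ℕ) :
    ∑ i ∈ range (p ^ m), ((1 : (ZMod p)[X]) + X) ^ (p ^ k * i) = X ^ (p ^ (k + m) - p ^ k) := by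
  have hle : p ^ k ≤ p ^ (k + m) := Nat.pow_le_pow_right hp.out.pos (Nat.le_add_right k m)
  have h := sum_pow_one_add_X_mul_X_pow p k m
  rw [← Nat.sub_add_cancel hle, pow_add] at h
  exact mul_right_cancel₀ (pow_ne_zero _ X_ne_zero) h

end Poly

/-! ## §2 The identity in any `𝔽_p`-algebra; nilpotence of `φ − 1` -/

section Alg

variable {p : ℕ} [hp : Fact p.Prime] {A : Type*} [Ring A] [Algebra (ZMod p) A]

/-- **`∑_{i<p^m} φ^{p^k i} = (φ − 1)^{p^{k+m} − p^k}`** for every element `φ` of an `𝔽_p`-algebra (evaluate §1 at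
`X ↦ φ − 1`). Applied to `φ = conj_γ` on a mod-`p` cohomology group of the layer `K_{k+m}`, the left side is the norm
`N_{K_{k+m}/K_k}`. [cite: Washington1997, §13.2] -/
theorem sum_pow_eq_sub_one_pow (φ : A) (k m : ℕ) :
    ∑ i ∈ range (p ^ m), φ ^ (p ^ k * i) = (φ - 1) ^ (p ^ (k + m) - p ^ k) := by
  have h := congrArg (Polynomial.aeval (R := ZMod p) (φ - 1)) (sum_pow_one_add_X_eq_X_pow p k m)
  simp only [map_sum, map_pow, map_add, map_one, aeval_X, add_sub_cancel] at h
  exact h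

/-- `φ^{p^N} = 1 ⟹ (φ − 1)^{p^N} = 0` in an `𝔽_p`-algebra. [folklore] -/
theorem sub_one_pow_prime_pow_eq_zero {φ : A} {N : ℕ} (hφ : φ ^ p ^ N = 1) : (φ - 1) ^ p ^ N = 0 := by
  have h := congrArg (Polynomial.aeval (R := ZMod p) (φ - 1)) (one_add_X_pow_prime_pow p N)
  simp only [map_pow, map_add, map_one, aeval_X, add_sub_cancel, hφ] at h
  -- h : 1 = 1 + (φ - 1) ^ p ^ N
  have h' : (1 : A) + (φ - 1) ^ p ^ N = 1 + 0 := by rw [add_zero]; exact h.symm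
  exact add_left_cancel h'

end Alg

/-! ## §3 Iterates of an endomorphism on a vector: linear independence up to the last non-zero one -/

section LinAlg

variable {F V : Type*} [Field F] [AddCommGroup V] [Module F V]

/-- **`ψ^j u ≠ 0`, `ψ^{j+1} u = 0` ⟹ `(ψ^i u)_{i ≤ j}` is linearly independent.** [folklore] -/
theorem linearIndependent_pow_apply (ψ : V →ₗ[F] V) (u : V) (j : ℕ) (hj : (ψ ^ j) u ≠ 0)
    (hj1 : (ψ ^ (j + 1)) u = 0) : LinearIndependent F (fun i : Fin (j + 1) => (ψ ^ (i : ℕ)) u) := by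
  -- all iterates beyond `j` vanish
  have hkill : ∀ t : ℕ, j + 1 ≤ t → (ψ ^ t) u = 0 := fun t ht ↦ by
    obtain ⟨s, rfl⟩ := Nat.exists_eq_add_of_le ht
    rw [add_comm, pow_add, Module.End.mul_apply, hj1, map_zero]
  rw [Fintype.linearIndependent_iff]
  intro c hc
  -- if some coefficient is non-zero, take the least index `i₀` with `c i₀ ≠ 0` and apply `ψ^{j - i₀}`
  by_contra hne
  simp only [not_forall] at hne
  obtain ⟨i₁, hi₁⟩ := hne
  classical
  let P : ℕ → Prop := fun t => ∃ i : Fin (j + 1), (i : ℕ) = t ∧ c i ≠ 0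
  have hP : ∃ t, P t := ⟨i₁, i₁, rfl, hi₁⟩
  let t₀ := Nat.find hP
  obtain ⟨i₀, hi₀t, hi₀⟩ : P t₀ := Nat.find_spec hP
  have hmin : ∀ i : Fin (j + 1), (i : ℕ) < t₀ → c i = 0 := fun i hi ↦ by
    by_contra h
    exact Nat.find_min hP hi ⟨i, rfl, h⟩
  have ht₀j : t₀ ≤ j := by rw [← hi₀t]; exact Nat.lt_succ_iff.mp i₀.2
  -- apply `ψ^{j - t₀}` to the relation
  have happ := congrArg (ψ ^ (j - t₀)) hc
  rw [map_sum, map_zero] at happ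
  have hterm : ∀ i : Fin (j + 1), (ψ ^ (j - t₀)) (c i • (ψ ^ (i : ℕ)) u) =
      if (i : ℕ) = t₀ then c i • (ψ ^ j) u else 0 := by
    intro i
    rw [map_smul, ← Module.End.mul_apply, ← pow_add]
    split_ifs with h
    · rw [h, Nat.sub_add_cancel ht₀j]
    · rcases lt_or_gt_of_ne h with hlt | hgt
      · rw [hmin i hlt, zero_smul]
      · rw [hkill _ (by omega), smul_zero]
  simp_rw [hterm] at happ
  rw [Finset.sum_ite, Finset.sum_const_zero, add_zero] at happ
  have hfilter : (Finset.univ.filter fun i : Fin (j + 1) => (i : ℕ) = t₀) = {i₀} := by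
    ext i
    simp only [Finset.mem_filter, Finset.mem_univ, true_and, Finset.mem_singleton]
    constructor
    · intro h; exact Fin.ext (h.trans hi₀t.symm)
    · intro h; rw [h, hi₀t]
  rw [hfilter, Finset.sum_singleton] at happ
  exact hi₀ ((smul_eq_zero.mp happ).resolve_right hj)

/-- From a non-zero iterate `ψ^i u ≠ 0` and a killing power `ψ^N u = 0`: a LAST non-zero iterate `ψ^j u ≠ 0`,
`ψ^{j+1} u = 0`, with `i ≤ j`. [folklore] -/
theorem exists_pow_apply_ne_zero_and_succ_eq_zero (ψ : V →ₗ[F] V) (u : V) {i N : ℕ}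
    (hi : (ψ ^ i) u ≠ 0) (hN : (ψ ^ N) u = 0) :
    ∃ j : ℕ, i ≤ j ∧ (ψ ^ j) u ≠ 0 ∧ (ψ ^ (j + 1)) u = 0 := by
  classical
  have hiN : i < N := by
    by_contra h
    obtain ⟨s, rfl⟩ := Nat.exists_eq_add_of_le (not_lt.mp h)
    exact hi (by rw [add_comm, pow_add, Module.End.mul_apply, hN, map_zero])
  have hex : ∃ t, i ≤ t ∧ (ψ ^ (t + 1)) u = 0 :=
    ⟨N - 1, by omega, by rw [Nat.sub_add_cancel (by omega)]; exact hN⟩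
  refine ⟨Nat.find hex, (Nat.find_spec hex).1, fun hzero ↦ ?_, (Nat.find_spec hex).2⟩
  rcases (Nat.find_spec hex).1.eq_or_lt with hij | hij
  · exact hi (by rw [hij]; exact hzero)
  · exact Nat.find_min hex (m := Nat.find hex - 1) (by omega)
      ⟨by omega, by rw [Nat.sub_add_cancel (by omega)]; exact hzero⟩

end LinAlg

/-! ## §4 The span forced by a non-zero norm -/

section Span

variable {p : ℕ} [hp : Fact p.Prime] {V : Type*} [AddCommGroup V] [Module (ZMod p) V]

/-- The span of the `φ`-orbit of `u` is `φ`-stable. [folklore] -/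
theorem map_span_orbit_le (φ : V →ₗ[ZMod p] V) (u : V) :
    (Submodule.span (ZMod p) (Set.range fun i : ℕ => (φ ^ i) u)).map φ ≤
      Submodule.span (ZMod p) (Set.range fun i : ℕ => (φ ^ i) u) := by
  rw [Submodule.map_span]
  refine Submodule.span_mono ?_
  rintro _ ⟨_, ⟨i, rfl⟩, rfl⟩
  exact ⟨i + 1, by simp only [pow_succ', Module.End.mul_apply]⟩

/-- Every iterate `(φ − 1)^i u` lies in the span of the `φ`-orbit of `u`. [folklore] -/
theorem sub_one_pow_apply_mem_span_orbit (φ : V →ₗ[ZMod p] V) (u : V) (i : ℕ) :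
    ((φ - 1) ^ i) u ∈ Submodule.span (ZMod p) (Set.range fun i : ℕ => (φ ^ i) u) := by
  induction i with
  | zero => exact Submodule.subset_span ⟨0, by simp only [pow_zero]⟩
  | succ i ih =>
    rw [pow_succ', Module.End.mul_apply, LinearMap.sub_apply, Module.End.one_apply]
    exact Submodule.sub_mem _ (map_span_orbit_le φ u ⟨_, ih, rfl⟩) ih

/-- **The span forced by a non-zero norm.** `V` an `𝔽_p`-vector space, `φ ∈ End(V)` of `p`-power order
(`φ^{p^N} = 1`), `u ∈ V` with `(∑_{i<p^m} φ^{p^k i}) u ≠ 0` (the NORM of the layer `K_{k+m}/K_k` does not kill `u`): then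
every finite-dimensional subspace containing the `φ`-orbit of `u` has dimension `≥ p^{k+m} − p^k + 1` (the orbit spans
`𝔽_p[T]/(T^j)·u` with `j > p^{k+m} − p^k`, §1–§3). In the port: `V` = a mod-3 local cohomology group at a prime above 3 of
the layer `K_n`, `φ = conj_γ`, `u` = the localisation of the Kummer class of the Heegner point `z_n`, non-zero norm = K1 at
layer `k` transported by the norm relation. [cite: Washington1997, §13.2] -/
theorem succ_le_finrank_of_sum_pow_apply_ne_zero (φ : V →ₗ[ZMod p] V) {N : ℕ} (hφ : φ ^ p ^ N = 1)
    (u : V) (k m : ℕ) (hu : (∑ i ∈ range (p ^ m), φ ^ (p ^ k * i)) u ≠ 0)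
    (W : Submodule (ZMod p) V) [Module.Finite (ZMod p) W] (hW : ∀ i : ℕ, (φ ^ i) u ∈ W) :
    p ^ (k + m) - p ^ k + 1 ≤ Module.finrank (ZMod p) W := by
  set ψ : V →ₗ[ZMod p] V := φ - 1 with hψ
  rw [sum_pow_eq_sub_one_pow φ k m] at hu
  have hN : (ψ ^ p ^ N) u = 0 := by
    rw [hψ, sub_one_pow_prime_pow_eq_zero hφ, LinearMap.zero_apply]
  obtain ⟨j, hij, hj, hj1⟩ := exists_pow_apply_ne_zero_and_succ_eq_zero ψ u hu hN
  -- the orbit span sits inside `W`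
  have hle : Submodule.span (ZMod p) (Set.range fun i : ℕ => (φ ^ i) u) ≤ W :=
    Submodule.span_le.mpr (by rintro _ ⟨i, rfl⟩; exact hW i)
  have hmem : ∀ i : ℕ, (ψ ^ i) u ∈ W := fun i ↦ hle (sub_one_pow_apply_mem_span_orbit φ u i)
  -- the independent family `(ψ^i u)_{i ≤ j}` inside `W`
  let g : Fin (j + 1) → W := fun i => ⟨(ψ ^ (i : ℕ)) u, hmem i⟩
  have hg : LinearIndependent (ZMod p) g := by
    refine LinearIndependent.of_comp W.subtype ?_
    exact linearIndependent_pow_apply ψ u j hj hj1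
  have hcard := hg.fintype_card_le_finrank
  rw [Fintype.card_fin] at hcard
  omega

end Span

end Summit.BirchSwinnertonDyer.BirchSwinnertonDyer.Theorems.UniversalToricDescentResidualNormSpan
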